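import Mathlib
import HarnessLib
import Summits.HubbardSuperconductivity.HubbardSuperconductivity.Theorems.KLProgrammeKLRegimeWickReplicaMoments

/-!
# Route `KLProgramme` — ENGINE child (E2-v9): the INTER- and INTRA-CLUSTER SPLIT of a Gaussian convolution on cluster-supported factors
# (generic; the mechanism behind `wickStar_eq_dblFold_gaussConv_cross` and the diagonal-undo lemma, stated once for an arbitrary cluster map —
# the brick for E2-WICK-ROADMAP §5 (i) second half; cell gate-hubbard-kl, seat p1 g8)

For a cluster map `cl : Γ → ι` and a set `A` of clusters, split a covariance `C'` into the pairs INSIDE `A` (`inCov`), inside `Aᶜ` (`outCov`) and ACROSS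
(`crossCovOf`): `C' = inCov + outCov + crossCovOf` (`cov_eq_in_add_out_add_cross`).  For `x` EVEN and supported on the clusters of `A` and `y` supported on the
clusters of `Aᶜ`:

  `e^{Δ_{C'}} (x · y) = e^{Δ_{crossCovOf C' A}} ( (e^{Δ_{inCov C' A}} x) · (e^{Δ_{outCov C' A}} y) )`        (`gaussConv_mul_clusterSplit`)

— the contractions inside each side act on that side alone; only the cross pairs see both.  With `cl = Prod.fst` on the replica labels and `A = {a}` this is the
replica-by-replica undo; with `cl = id`-blocks of a set partition it is the block gluing in the Wick cumulant formula
`e^{Δ_D}𝓔ᵀ_C = Σ_π μ(π) e^{Δ_{D inter-block}}(∏_{B∈π} ν_B)` (roadmap §5 (i)).  Proved; the three covariance pieces are the only definitions.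
-/

noncomputable section

namespace Summit.HubbardSuperconductivity.HubbardSuperconductivity.Theorems.KLRegimeWick

set_option linter.dupNamespace false -- summit = problem name (single-conjunct summit), D-0017

open Literature.MathematicalPhysics.QuantumLattice GrassmannAlgebra Finset Matrix

section Cluster

variable (R : Type*) [CommRing R] {Γ : Type*} [Fintype Γ] [DecidableEq Γ] {ι : Type*} (cl : Γ → ι) (A : Set ι)
  [DecidablePred (· ∈ A)]

/-- The pairs of `C'` with BOTH labels in the clusters of `A`. -/
def inCov (C' : Matrix Γ Γ R) : Matrix Γ Γ R := Matrix.of fun X Y => if cl X ∈ A ∧ cl Y ∈ A then C' X Y else 0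

/-- The pairs of `C'` with BOTH labels outside the clusters of `A`. -/
def outCov (C' : Matrix Γ Γ R) : Matrix Γ Γ R := Matrix.of fun X Y => if cl X ∉ A ∧ cl Y ∉ A then C' X Y else 0

/-- The pairs of `C'` ACROSS: one label in the clusters of `A`, the other outside. -/
def crossCovOf (C' : Matrix Γ Γ R) : Matrix Γ Γ R :=
  Matrix.of fun X Y => if (cl X ∈ A ∧ cl Y ∉ A) ∨ (cl X ∉ A ∧ cl Y ∈ A) then C' X Y else 0

omit [Fintype Γ] [DecidableEq Γ] in
/-- `C' = inCov + outCov + crossCovOf`. -/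
theorem cov_eq_in_add_out_add_cross (C' : Matrix Γ Γ R) : C' = inCov R cl A C' + outCov R cl A C' + crossCovOf R cl A C' := by
  ext X Y
  simp only [inCov, outCov, crossCovOf, Matrix.add_apply, Matrix.of_apply]
  by_cases hX : cl X ∈ A <;> by_cases hY : cl Y ∈ A <;> simp [hX, hY]

omit [Fintype Γ] [DecidableEq Γ] in
/-- `inCov` charges no label outside the clusters of `A`. -/
theorem inCov_eq_zero_of_mem (C' : Matrix Γ Γ R) (X Y : Γ) (h : X ∈ cl ⁻¹' Aᶜ ∨ Y ∈ cl ⁻¹' Aᶜ) : inCov R cl A C' X Y = 0 := by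
  simp only [Set.mem_preimage, Set.mem_compl_iff] at h
  rw [inCov, Matrix.of_apply, if_neg]
  rintro ⟨hX, hY⟩
  rcases h with h | h
  · exact h hX
  · exact h hY

omit [Fintype Γ] [DecidableEq Γ] in
/-- `outCov` charges no label inside the clusters of `A`. -/
theorem outCov_eq_zero_of_mem (C' : Matrix Γ Γ R) (X Y : Γ) (h : X ∈ cl ⁻¹' A ∨ Y ∈ cl ⁻¹' A) : outCov R cl A C' X Y = 0 := by
  simp only [Set.mem_preimage] at h
  rw [outCov, Matrix.of_apply, if_neg]
  rintro ⟨hX, hY⟩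
  rcases h with h | h
  · exact hX h
  · exact hY h

variable [Algebra ℚ R]

/-- **The inter- and intra-cluster split**: for `x` even and supported on the clusters of `A`, `y` supported on the clusters of `Aᶜ`,
`e^{Δ_{C'}}(x·y) = e^{Δ_{cross}}((e^{Δ_{in}} x)·(e^{Δ_{out}} y))`. -/
theorem gaussConv_mul_clusterSplit (C' : Matrix Γ Γ R) {x y : GrassmannAlgebra R Γ} (hx : x ∈ fieldSubalgebra R (cl ⁻¹' A))
    (hx0 : x ∈ evenOdd R 0) (hy : y ∈ fieldSubalgebra R (cl ⁻¹' Aᶜ)) :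
    gaussConv R C' (x * y) =
      gaussConv R (crossCovOf R cl A C') (gaussConv R (inCov R cl A C') x * gaussConv R (outCov R cl A C') y) := by
  conv_lhs => rw [cov_eq_in_add_out_add_cross R cl A C']
  rw [add_comm, gaussConv_add_apply, gaussConv_add_apply]
  -- `outCov` acts on the right factor only (charges no label of `cl⁻¹ A`, where `x` lives)
  rw [gaussConv_mul_eq_mul_of_mem R (outCov R cl A C') (fun X Y h => outCov_eq_zero_of_mem R cl A C' X Y h) hx hx0]
  -- `inCov` acts on the left factor only (charges no label of `cl⁻¹ Aᶜ`, where `e^{Δ_out} y` lives)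
  rw [gaussConv_mul_eq_mul_of_mem_right R (inCov R cl A C') (fun X Y h => inCov_eq_zero_of_mem R cl A C' X Y h) _
    (gaussConv_mem_fieldSubalgebra R _ hy)]

/-- The same with the roles named for a set partition block: taking `A` = one block, the intra-block convolutions factor off. -/
theorem gaussConv_mul_clusterSplit' (C' : Matrix Γ Γ R) {x y : GrassmannAlgebra R Γ} (hx : x ∈ fieldSubalgebra R (cl ⁻¹' A))
    (hx0 : x ∈ evenOdd R 0) (hy : y ∈ fieldSubalgebra R (cl ⁻¹' Aᶜ)) (hin : inCov R cl A C' = 0) (hout : outCov R cl A C' = 0) :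
    gaussConv R C' (x * y) = gaussConv R (crossCovOf R cl A C') (x * y) := by
  rw [gaussConv_mul_clusterSplit R cl A C' hx hx0 hy, hin, hout, gaussConv_zero, Module.End.one_apply, Module.End.one_apply]

end Cluster

end Summit.HubbardSuperconductivity.HubbardSuperconductivity.Theorems.KLRegimeWick

end
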